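import Literature.Computability.AlgebraicComplexity.BigCwFourthComponents
import HarnessLib

/-!
# Tools for the numerical evaluation of the laser method on `CW_5^{⊗4}`: product-form
distributions, certified entropy bounds and logarithms — proved

Topic `Literature/Computability/AlgebraicComplexity`.  Le Gall, *Powers of tensors and fast matrix
multiplication* (ISSAC 2014, arXiv:1401.7714), §6.3 obtains `ω < 2.3729269` from `CW_q^{⊗4}` with
`q = 5` by "Algorithm B", i.e. Theorem 4.1 with probability distributions satisfying the conditions
of Proposition 4.1 (`Γ_S(P) = 0`): these are exactly the distributions of PRODUCT FORM
`P(i,j,l) = f(i) g(j) h(l) / Z` on the support (the two "highly non-convex constraints" of §6.3 are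
the equations of this family for `supp(t^{⊗4})`).  This file supplies the generic, proved tools with
which the files `BigCwFourthValues*.lean` / `BigCwFourthOmega.lean` certify that computation at an
exact rational point:

* `prodFormZ`, `prodFormDist S f g h` — the product-form distribution on a finite set `S`, with
  `prodFormDist_nonneg`, `sum_prodFormDist`, `prodFormDist_eq_zero`, `prodFormDist_apply_of_mem`,
  `prodFormDist_mem_stdSimplex` and **`maxEntropyPenalty_prodFormDist : Γ_S(P) = 0`** (Le Gall
  Prop. 4.1, through `maxEntropyPenalty_eq_zero_of_mul`);
* certified entropy: `negMulLog_ge_tangent` — `η(p) ≥ −p ln Q − p(p − Q)/Q` for any `Q > 0` (from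
  `ln x ≤ x − 1`), and `sum_negMulLog_le_shannonEntropy_mul` — `∑_{x ∈ T} η(P x) ≤ H(P) ln 2` for a
  sub-family `T` (so that entropies of exact rational marginals are bounded below by linear forms in
  logarithms of smooth numbers);
* `log_laserBound` — `ln(2^A ∏_{s∈S} W(s)^{P(s)}) = A ln 2 + ∑_{s∈S} P(s) ln W(s)`;
  `rpow_div_three_cube_eq_exp` — `((N)^{ρ/3})³ = e^{ρ ln N}`;
* the constants of the evaluation, `cwRho = 2.37295`, `cwSig = 24/25` (`σ` of the `[112]` value),
  and the logarithms of the level-2 values `cwVal2 5 cwRho cwSig` of the four types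
  (`log_cwVal2_*`) as linear forms in `ln 2, ln 3, ln 5`;
* two-sided certified bounds for `ln 3, ln 5, ln 7, ln 11, ln 19` completing those of
  `BigCwSquareOmega.lean` (`log_*_series'`), from the Taylor bounds `log_one_sub_bounds`.

Everything is proved; no named facts.

## References

* F. Le Gall, ISSAC 2014, arXiv:1401.7714 (held: `paper:arxiv-1401.7714`): Prop. 4.1, §6.3,
  Tables 2–3. [LeGall2014]
-/

noncomputable section

open scoped BigOperators
open Finset Real

namespace Literature.Computability.AlgebraicComplexity

universe u

/-! ## Product-form distributions -/

section ProdForm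

variable {A B C : Type*}

/-- The normalising constant `Z = ∑_{s ∈ S} f(s₁) g(s₂) h(s₃)`. [cite: LeGall2014, Prop. 4.1] -/
def prodFormZ (S : Finset (A × B × C)) (f : A → ℝ) (g : B → ℝ) (h : C → ℝ) : ℝ :=
  ∑ s ∈ S, f s.1 * g s.2.1 * h s.2.2

/-- `Z > 0` for positive weights on a non-empty `S`. [folklore] -/
theorem prodFormZ_pos {S : Finset (A × B × C)} {f : A → ℝ} {g : B → ℝ} {h : C → ℝ}
    (hf : ∀ a, 0 < f a) (hg : ∀ b, 0 < g b) (hh : ∀ c, 0 < h c) (hS : S.Nonempty) :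
    0 < prodFormZ S f g h :=
  Finset.sum_pos (fun _ _ => mul_pos (mul_pos (hf _) (hg _)) (hh _)) hS

variable [DecidableEq A] [DecidableEq B] [DecidableEq C]

/-- **The product-form distribution `P(s) = f(s₁) g(s₂) h(s₃) / Z` on `S`** (and `0` off `S`): the
distributions satisfying Conditions (i)–(ii) of Le Gall's Proposition 4.1, for which `Γ_S(P) = 0`
("Algorithm B"). [cite: LeGall2014, Prop. 4.1 and Fig. 2] -/
def prodFormDist (S : Finset (A × B × C)) (f : A → ℝ) (g : B → ℝ) (h : C → ℝ) (s : A × B × C) : ℝ :=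
  if s ∈ S then f s.1 * g s.2.1 * h s.2.2 / prodFormZ S f g h else 0

variable {S : Finset (A × B × C)} {f : A → ℝ} {g : B → ℝ} {h : C → ℝ}

/-- `P` vanishes off `S`. [folklore] -/
theorem prodFormDist_eq_zero (s : A × B × C) (hs : s ∉ S) : prodFormDist S f g h s = 0 := by
  simp [prodFormDist, hs]

/-- `P` on `S`. [folklore] -/
theorem prodFormDist_apply_of_mem {s : A × B × C} (hs : s ∈ S) :
    prodFormDist S f g h s = f s.1 * g s.2.1 * h s.2.2 / prodFormZ S f g h := by
  simp [prodFormDist, hs]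

/-- `P ≥ 0`. [folklore] -/
theorem prodFormDist_nonneg (hf : ∀ a, 0 < f a) (hg : ∀ b, 0 < g b) (hh : ∀ c, 0 < h c)
    (hS : S.Nonempty) (s : A × B × C) : 0 ≤ prodFormDist S f g h s := by
  simp only [prodFormDist]
  split_ifs
  · exact div_nonneg (mul_pos (mul_pos (hf _) (hg _)) (hh _)).le (prodFormZ_pos hf hg hh hS).le
  · exact le_rfl

variable [Fintype A] [Fintype B] [Fintype C]

/-- `∑ P = 1`. [folklore] -/
theorem sum_prodFormDist (hf : ∀ a, 0 < f a) (hg : ∀ b, 0 < g b) (hh : ∀ c, 0 < h c)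
    (hS : S.Nonempty) : ∑ s, prodFormDist S f g h s = 1 := by
  rw [← Finset.sum_subset (Finset.subset_univ S) (fun s _ hs => prodFormDist_eq_zero s hs)]
  rw [Finset.sum_congr rfl fun s hs => prodFormDist_apply_of_mem (f := f) (g := g) (h := h) hs,
    ← Finset.sum_div]
  exact div_self (prodFormZ_pos hf hg hh hS).ne'

/-- `P` is a probability distribution. [folklore] -/
theorem prodFormDist_mem_stdSimplex (hf : ∀ a, 0 < f a) (hg : ∀ b, 0 < g b) (hh : ∀ c, 0 < h c)
    (hS : S.Nonempty) : prodFormDist S f g h ∈ stdSimplex ℝ (A × B × C) :=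
  ⟨prodFormDist_nonneg hf hg hh hS, sum_prodFormDist hf hg hh hS⟩

/-- **`Γ_S(P) = 0` for the product-form distribution** (Le Gall Prop. 4.1: Conditions (i)–(ii)).
[cite: LeGall2014, Prop. 4.1] -/
theorem maxEntropyPenalty_prodFormDist (hf : ∀ a, 0 < f a) (hg : ∀ b, 0 < g b) (hh : ∀ c, 0 < h c)
    (hS : S.Nonempty) : maxEntropyPenalty S (prodFormDist S f g h) = 0 := by
  have hZ := prodFormZ_pos hf hg hh hS
  refine maxEntropyPenalty_eq_zero_of_mul S (prodFormDist_mem_stdSimplex hf hg hh hS)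
    prodFormDist_eq_zero (fun a => f a / prodFormZ S f g h) g h (fun s _ => div_pos (hf _) hZ)
    (fun s _ => hg _) (fun s _ => hh _) fun s hs => ?_
  rw [prodFormDist_apply_of_mem hs]
  ring

end ProdForm

/-! ## Certified entropy bounds -/

section Entropy

/-- **The tangent bound for `η`**: `η(p) = −p ln p ≥ −p ln Q − p (p − Q)/Q` for `p ≥ 0`, `Q > 0`
(`ln (p/Q) ≤ p/Q − 1`). [folklore] -/
theorem negMulLog_ge_tangent {p Q : ℝ} (hp : 0 ≤ p) (hQ : 0 < Q) :
    -(p * Real.log Q) - p * (p - Q) / Q ≤ negMulLog p := by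
  rcases hp.eq_or_lt with rfl | hp'
  · simp [negMulLog]
  · have h := Real.log_le_sub_one_of_pos (div_pos hp' hQ)
    rw [Real.log_div hp'.ne' hQ.ne'] at h
    rw [negMulLog]
    have e : p * (p - Q) / Q = p * (p / Q - 1) := by field_simp
    rw [e]
    nlinarith [mul_le_mul_of_nonneg_left h hp]

variable {α : Type*} [Fintype α]

/-- **Partial sums of `η` bound the entropy below**: `∑_{x ∈ T} η(P x) ≤ H(P) ln 2` for
`0 ≤ P ≤ 1`. [folklore] -/
theorem sum_negMulLog_le_shannonEntropy_mul (P : α → ℝ) (h0 : ∀ x, 0 ≤ P x) (h1 : ∀ x, P x ≤ 1)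
    (T : Finset α) : ∑ x ∈ T, negMulLog (P x) ≤ shannonEntropy P * Real.log 2 := by
  rw [shannonEntropy_def, div_mul_cancel₀ _ (Real.log_pos one_lt_two).ne']
  exact Finset.sum_le_univ_sum_of_nonneg fun x => Real.negMulLog_nonneg (h0 x) (h1 x)

/-- Partial-sum bound for the entropy of a marginal of a probability distribution (first slot). [folklore] -/
theorem sum_negMulLog_marginalDist₁_le {ι κ μ : Type*} [Fintype ι] [Fintype κ] [Fintype μ]
    {P : ι × κ × μ → ℝ} (hP : P ∈ stdSimplex ℝ (ι × κ × μ)) (T : Finset ι) :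
    ∑ x ∈ T, negMulLog (marginalDist₁ P x) ≤ shannonEntropy (marginalDist₁ P) * Real.log 2 :=
  sum_negMulLog_le_shannonEntropy_mul _ (marginalDist₁_mem_stdSimplex hP).1
    (le_one_of_mem_stdSimplex (marginalDist₁_mem_stdSimplex hP)) T

/-- Partial-sum bound (second slot). [folklore] -/
theorem sum_negMulLog_marginalDist₂_le {ι κ μ : Type*} [Fintype ι] [Fintype κ] [Fintype μ]
    {P : ι × κ × μ → ℝ} (hP : P ∈ stdSimplex ℝ (ι × κ × μ)) (T : Finset κ) :
    ∑ x ∈ T, negMulLog (marginalDist₂ P x) ≤ shannonEntropy (marginalDist₂ P) * Real.log 2 :=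
  sum_negMulLog_le_shannonEntropy_mul _ (marginalDist₂_mem_stdSimplex hP).1
    (le_one_of_mem_stdSimplex (marginalDist₂_mem_stdSimplex hP)) T

/-- Partial-sum bound (third slot). [folklore] -/
theorem sum_negMulLog_marginalDist₃_le {ι κ μ : Type*} [Fintype ι] [Fintype κ] [Fintype μ]
    {P : ι × κ × μ → ℝ} (hP : P ∈ stdSimplex ℝ (ι × κ × μ)) (T : Finset μ) :
    ∑ x ∈ T, negMulLog (marginalDist₃ P x) ≤ shannonEntropy (marginalDist₃ P) * Real.log 2 :=
  sum_negMulLog_le_shannonEntropy_mul _ (marginalDist₃_mem_stdSimplex hP).1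
    (le_one_of_mem_stdSimplex (marginalDist₃_mem_stdSimplex hP)) T

end Entropy

/-! ## Logarithms of the value expressions -/

section LogValue

variable {α : Type*}

/-- **`ln (2^A · ∏_{s∈S} W(s)^{P(s)}) = A ln 2 + ∑_{s∈S} P(s) ln W(s)`** for positive `W` on `S`. [folklore] -/
theorem log_laserBound (A : ℝ) (S : Finset α) (W P : α → ℝ) (hW : ∀ s ∈ S, 0 < W s) :
    Real.log ((2 : ℝ) ^ A * ∏ s ∈ S, W s ^ P s) = A * Real.log 2 + ∑ s ∈ S, P s * Real.log (W s) := by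
  have hprod : 0 < ∏ s ∈ S, W s ^ P s := Finset.prod_pos fun s hs => Real.rpow_pos_of_pos (hW s hs) _
  rw [Real.log_mul (Real.rpow_pos_of_pos two_pos _).ne' hprod.ne', Real.log_rpow two_pos,
    Real.log_prod (fun s hs => (Real.rpow_pos_of_pos (hW s hs) _).ne')]
  congr 1
  exact Finset.sum_congr rfl fun s hs => Real.log_rpow (hW s hs) _

/-- The product with exponential values: `∏_{s∈S} (e^{L s})^{P s} = e^{∑ P s · L s}`. [folklore] -/
theorem prod_exp_rpow (S : Finset α) (L P : α → ℝ) :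
    ∏ s ∈ S, Real.exp (L s) ^ P s = Real.exp (∑ s ∈ S, P s * L s) := by
  rw [Real.exp_sum]
  refine Finset.prod_congr rfl fun s _ => ?_
  rw [← Real.exp_mul, mul_comm]

/-- `((N)^{ρ/3})³ = e^{ρ ln N}` for `N > 0`. [folklore] -/
theorem rpow_div_three_cube_eq_exp {N : ℝ} (hN : 0 < N) (ρ : ℝ) :
    (N ^ (ρ / 3)) ^ 3 = Real.exp (ρ * Real.log N) := by
  rw [← Real.rpow_natCast, ← Real.rpow_mul hN.le, Real.rpow_def_of_pos hN]
  congr 1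
  push_cast
  ring

end LogValue

/-! ## The evaluation point `q = 5`, `ρ = 2.37295`, `σ = 24/25` -/

section Constants

/-- **`ρ = 2.37295`**, the exponent certified below (Le Gall Table 2, `r = 2`: `ω < 2.3729372` by
Algorithm A, `ω < 2.3729269` by Algorithm B; with `σ` rounded to `24/25` the product-form optimum
is at `≈ 2.37294`, and `6.8·10⁻⁵` nats of slack at `2.37295` absorb the rational roundings).
[cite: LeGall2014, Table 2 and §6.3] -/
def cwRho : ℝ := 2.37295

/-- **`σ = 24/25`**, the parameter of the `[112]`-value `hasLaserValue_symm3_cwSqComp112`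
(Le Gall's `2 b₂`; optimal `≈ 0.958` at `q = 5`). [cite: LeGall2014, §6.2 (b₁, b₂)] -/
def cwSig : ℝ := 24 / 25

/-- `0 < σ`. [folklore] -/
theorem cwSig_pos : 0 < cwSig := by norm_num [cwSig]

/-- `σ < 1`. [folklore] -/
theorem cwSig_lt_one : cwSig < 1 := by norm_num [cwSig]

/-- `0 < ρ`. [folklore] -/
theorem cwRho_pos : 0 < cwRho := by norm_num [cwRho]

/-- `H_Z(σ)` in nats at `σ = 24/25`: `2η(1/50) + η(24/25)` as a linear form in `ln 2, ln 3, ln 5`. [folklore] -/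
theorem cwHZ_eq : 2 * negMulLog ((1 - cwSig) / 2) + negMulLog cwSig =
    -(71 / 25) * Real.log 2 - (24 / 25) * Real.log 3 + 2 * Real.log 5 := by
  have l50 : Real.log 50 = Real.log 2 + 2 * Real.log 5 := by
    rw [show (50 : ℝ) = 2 * 5 ^ 2 by norm_num, Real.log_mul (by norm_num) (by norm_num), Real.log_pow]; ring
  have l24 : Real.log 24 = 3 * Real.log 2 + Real.log 3 := by
    rw [show (24 : ℝ) = 2 ^ 3 * 3 by norm_num, Real.log_mul (by norm_num) (by norm_num), Real.log_pow]; ring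
  have l25 : Real.log 25 = 2 * Real.log 5 := by
    rw [show (25 : ℝ) = 5 ^ 2 by norm_num, Real.log_pow]; ring
  simp only [cwSig, negMulLog]
  rw [show ((1 : ℝ) - 24 / 25) / 2 = (50 : ℝ)⁻¹ by norm_num, Real.log_inv,
    Real.log_div (by norm_num) (by norm_num), l50, l24, l25]
  ring

/-- **`ln V₂` of the `[112]`-type at the evaluation point**:
`ln cwV112 = 2 ln 2 + H_Z(σ) + ρ(1+σ) ln 5`. [cite: CoppersmithWinograd1990, §8] -/
theorem log_cwV112 : Real.log (cwV112 5 cwRho cwSig) =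
    -(21 / 25) * Real.log 2 - (24 / 25) * Real.log 3 + (2 + cwRho * (49 / 25)) * Real.log 5 := by
  have h5 : (0 : ℝ) < ((5 : ℕ) : ℝ) := by norm_num
  rw [cwV112, Real.log_mul (Real.rpow_pos_of_pos two_pos _).ne' (pow_pos (Real.rpow_pos_of_pos h5 _) 3).ne',
    Real.log_rpow two_pos, ← Real.rpow_natCast, ← Real.rpow_mul h5.le, Real.log_rpow h5, add_mul,
    div_mul_cancel₀ _ (Real.log_pos one_lt_two).ne', cwHZ_eq]
  simp only [cwSig]
  push_cast
  ring

/-- `ln V₂ = 0` on the `[004]`-type. [cite: LeGall2014, §6.2] -/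
theorem log_cwVal2_of_max_eq_four (ρ σ : ℝ) (q : ℕ) (s : Fin 5 × Fin 5 × Fin 5)
    (h : max (s.1 : ℕ) (max s.2.1 s.2.2) = 4) : Real.log (cwVal2 q ρ σ s) = 0 := by
  rw [cwVal2, if_pos h, Real.log_one]

/-- `ln V₂ = ρ (ln 2 + ln 5)` on the `[013]`-type (`(2q)^ρ`, `q = 5`). [cite: LeGall2014, §6.2] -/
theorem log_cwVal2_of_max_eq_three (σ : ℝ) (s : Fin 5 × Fin 5 × Fin 5)
    (h : max (s.1 : ℕ) (max s.2.1 s.2.2) = 3) :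
    Real.log (cwVal2 5 cwRho σ s) = cwRho * Real.log 2 + cwRho * Real.log 5 := by
  have h4 : ¬ max (s.1 : ℕ) (max s.2.1 s.2.2) = 4 := by omega
  rw [cwVal2, if_neg h4, if_pos h]
  have h10 : (0 : ℝ) < ((2 * 5 : ℕ) : ℝ) := by norm_num
  rw [← Real.rpow_natCast, ← Real.rpow_mul h10.le, Real.log_rpow h10,
    show ((2 * 5 : ℕ) : ℝ) = 2 * 5 by norm_num, Real.log_mul (by norm_num) (by norm_num)]
  push_cast
  ring

/-- `ln V₂ = 3ρ ln 3` on the `[022]`-type (`(q²+2)^ρ = 27^ρ`). [cite: LeGall2014, §6.2] -/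
theorem log_cwVal2_of_min_eq_zero (σ : ℝ) (s : Fin 5 × Fin 5 × Fin 5)
    (h : max (s.1 : ℕ) (max s.2.1 s.2.2) = 2) (h' : min (s.1 : ℕ) (min s.2.1 s.2.2) = 0) :
    Real.log (cwVal2 5 cwRho σ s) = 3 * cwRho * Real.log 3 := by
  have h4 : ¬ max (s.1 : ℕ) (max s.2.1 s.2.2) = 4 := by omega
  have h3 : ¬ max (s.1 : ℕ) (max s.2.1 s.2.2) = 3 := by omega
  rw [cwVal2, if_neg h4, if_neg h3, if_pos h']
  have h27 : (0 : ℝ) < ((5 * 5 + 2 : ℕ) : ℝ) := by norm_num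
  rw [← Real.rpow_natCast, ← Real.rpow_mul h27.le, Real.log_rpow h27,
    show ((5 * 5 + 2 : ℕ) : ℝ) = 3 ^ 3 by norm_num, Real.log_pow]
  push_cast
  ring

/-- `ln V₂ = ln cwV112` on the `[112]`-type. [cite: LeGall2014, §6.2] -/
theorem log_cwVal2_of_min_eq_one (s : Fin 5 × Fin 5 × Fin 5)
    (h : max (s.1 : ℕ) (max s.2.1 s.2.2) = 2) (h' : min (s.1 : ℕ) (min s.2.1 s.2.2) = 1) :
    Real.log (cwVal2 5 cwRho cwSig s) =
      -(21 / 25) * Real.log 2 - (24 / 25) * Real.log 3 + (2 + cwRho * (49 / 25)) * Real.log 5 := by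
  have h4 : ¬ max (s.1 : ℕ) (max s.2.1 s.2.2) = 4 := by omega
  have h3 : ¬ max (s.1 : ℕ) (max s.2.1 s.2.2) = 3 := by omega
  have h0 : ¬ min (s.1 : ℕ) (min s.2.1 s.2.2) = 0 := by omega
  rw [cwVal2, if_neg h4, if_neg h3, if_neg h0]
  exact log_cwV112

end Constants

/-! ## Certified logarithms of small primes -/

section Logs

/-- `ln(2^a 3^b 5^c 7^d 11^e 19^f) = a ln 2 + b ln 3 + c ln 5 + d ln 7 + e ln 11 + f ln 19`. [folklore] -/
theorem log_prod_primes (a b c d e f : ℕ) :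
    Real.log ((2 : ℝ) ^ a * 3 ^ b * 5 ^ c * 7 ^ d * 11 ^ e * 19 ^ f) =
      (a : ℝ) * Real.log 2 + (b : ℝ) * Real.log 3 + (c : ℝ) * Real.log 5 + (d : ℝ) * Real.log 7 +
        (e : ℝ) * Real.log 11 + (f : ℝ) * Real.log 19 := by
  rw [Real.log_mul (by positivity) (by positivity), Real.log_mul (by positivity) (by positivity),
    Real.log_mul (by positivity) (by positivity), Real.log_mul (by positivity) (by positivity),
    Real.log_mul (by positivity) (by positivity), Real.log_pow, Real.log_pow, Real.log_pow, Real.log_pow,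
    Real.log_pow, Real.log_pow]

/-- `ln 3 ≤ 2 ln 2 − S + E` (series for `ln(1 − 1/4)`). [folklore] -/
theorem log_three_le_series : Real.log 3 ≤ 2 * Real.log 2 - 66895348819 / 232532213760 + (1 / 4 : ℝ) ^ 13 / (3 / 4) := by
  have h := (log_one_sub_bounds (x := (1 / 4 : ℝ)) (by norm_num) (by norm_num) 12).2
  have hs : ∑ i ∈ range 12, (1 / 4 : ℝ) ^ (i + 1) / (i + 1) = 66895348819 / 232532213760 := by
    simp only [sum_range_succ, sum_range_zero]; norm_num
  rw [hs] at h
  have e : Real.log 3 = 2 * Real.log 2 + Real.log (1 - 1 / 4) := by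
    rw [show (1 : ℝ) - 1 / 4 = 3 / 4 by norm_num, Real.log_div (by norm_num) (by norm_num),
      show (4 : ℝ) = 2 ^ 2 by norm_num, Real.log_pow]; push_cast; ring
  rw [e]; norm_num at h ⊢; linarith

/-- `ln 5 ≥ 2 ln 2 + S − E` (series for `ln(1 − 1/5)`). [folklore] -/
theorem log_five_ge_series : 2 * Real.log 2 + 5491423277 / 24609375000 - (1 / 5 : ℝ) ^ 11 / (4 / 5) ≤ Real.log 5 := by
  have h := (log_one_sub_bounds (x := (1 / 5 : ℝ)) (by norm_num) (by norm_num) 10).2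
  have hs : ∑ i ∈ range 10, (1 / 5 : ℝ) ^ (i + 1) / (i + 1) = 5491423277 / 24609375000 := by
    simp only [sum_range_succ, sum_range_zero]; norm_num
  rw [hs] at h
  have e : Real.log 5 = 2 * Real.log 2 - Real.log (1 - 1 / 5) := by
    rw [show (1 : ℝ) - 1 / 5 = 4 / 5 by norm_num, Real.log_div (by norm_num) (by norm_num),
      show (4 : ℝ) = 2 ^ 2 by norm_num, Real.log_pow]; push_cast; ring
  rw [e]; norm_num at h ⊢; linarith

/-- `ln 7 ≥ 3 ln 2 − S − E` (series for `ln(1 − 1/8)`). [folklore] -/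
theorem log_seven_ge_series : 3 * Real.log 2 - 1881839401 / 14092861440 - (1 / 8 : ℝ) ^ 9 / (7 / 8) ≤ Real.log 7 := by
  have h := (log_one_sub_bounds (x := (1 / 8 : ℝ)) (by norm_num) (by norm_num) 8).1
  have hs : ∑ i ∈ range 8, (1 / 8 : ℝ) ^ (i + 1) / (i + 1) = 1881839401 / 14092861440 := by
    simp only [sum_range_succ, sum_range_zero]; norm_num
  rw [hs] at h
  have e : Real.log 7 = 3 * Real.log 2 + Real.log (1 - 1 / 8) := by
    rw [show (1 : ℝ) - 1 / 8 = 7 / 8 by norm_num, Real.log_div (by norm_num) (by norm_num),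
      show (8 : ℝ) = 2 ^ 3 by norm_num, Real.log_pow]; push_cast; ring
  rw [e]; norm_num at h ⊢; linarith

/-- `ln 19 ≥ 2 ln 2 + ln 5 − S − E` (series for `ln(1 − 1/20)`). [folklore] -/
theorem log_nineteen_ge_series : 2 * Real.log 2 + Real.log 5 - 157573 / 3072000 - (1 / 20 : ℝ) ^ 7 / (19 / 20) ≤ Real.log 19 := by
  have h := (log_one_sub_bounds (x := (1 / 20 : ℝ)) (by norm_num) (by norm_num) 6).1
  have hs : ∑ i ∈ range 6, (1 / 20 : ℝ) ^ (i + 1) / (i + 1) = 157573 / 3072000 := by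
    simp only [sum_range_succ, sum_range_zero]; norm_num
  rw [hs] at h
  have e : Real.log 19 = 2 * Real.log 2 + Real.log 5 + Real.log (1 - 1 / 20) := by
    rw [show (1 : ℝ) - 1 / 20 = 19 / 20 by norm_num, Real.log_div (by norm_num) (by norm_num),
      show (20 : ℝ) = 2 ^ 2 * 5 by norm_num, Real.log_mul (by norm_num) (by norm_num), Real.log_pow]
    push_cast; ring
  rw [e]; norm_num at h ⊢; linarith

/-- Two-sided bound for `ln 11 = 2 ln 2 + ln 3 + ln(1 − 1/12)`. [folklore] -/
theorem log_eleven_bounds :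
    2 * Real.log 2 + Real.log 3 - 10475723843 / 120394874880 - (1 / 12 : ℝ) ^ 9 / (11 / 12) ≤ Real.log 11 ∧
      Real.log 11 ≤ 2 * Real.log 2 + Real.log 3 - 10475723843 / 120394874880 + (1 / 12 : ℝ) ^ 9 / (11 / 12) := by
  have h := log_one_sub_bounds (x := (1 / 12 : ℝ)) (by norm_num) (by norm_num) 8
  have hs : ∑ i ∈ range 8, (1 / 12 : ℝ) ^ (i + 1) / (i + 1) = 10475723843 / 120394874880 := by
    simp only [sum_range_succ, sum_range_zero]; norm_num
  rw [hs] at h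
  have e : Real.log 11 = 2 * Real.log 2 + Real.log 3 + Real.log (1 - 1 / 12) := by
    rw [show (1 : ℝ) - 1 / 12 = 11 / 12 by norm_num, Real.log_div (by norm_num) (by norm_num),
      show (12 : ℝ) = 2 ^ 2 * 3 by norm_num, Real.log_mul (by norm_num) (by norm_num), Real.log_pow]
    push_cast; ring
  rw [e]; norm_num at h ⊢; constructor <;> linarith [h.1, h.2]

end Logs

end Literature.Computability.AlgebraicComplexity
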